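import Literature.NumberTheory.Sieve.Maynard2016GPYReduction
import Literature.NumberTheory.LFunctions.PrimeNumberTheoremErrorTerm
import HarnessLib

/-!
# Maynard 2016, §3: Proposition 5′ ⇒ Proposition 5 (the equivalence of the two forms)

Topic `Literature/NumberTheory/Sieve`. J. Maynard, *Large gaps between primes*, Ann. of Math. 183
(2016), §3, first paragraph: "By appending an interval of length `2ε|𝓡_m| log x` to `𝓘_m` and
using one residue class for each of the primes in this interval to remove each one of the `ε|𝓡_m|`
remaining elements, we see that these two forms of Proposition 5 are equivalent."

This file PROVES that direction,

  `proposition5_of_prime : Proposition5Prime → Lemma3 → ChebyshevThetaDeLaValleePoussin → Proposition5`,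

with the two analytic inputs the sentence uses silently made explicit:
* the appended interval `(B′, B] ⊆ [x/2, x]` has length `≍ |𝓡_m| log x`, which may be as small as
  `x/(log x)^3`; that it contains `≫ |𝓡_m|` primes is the prime number theorem with an error term
  `O(x/(log x)^6)` — here from de la Vallée Poussin's form
  `Literature.NumberTheory.LFunctions.ChebyshevThetaDeLaValleePoussin` (a named fact of the tree)
  via its corollary `.logPow`;
* `|𝓡_m| ≫ x/(log x)^4` for the relevant `m` (even, `m < U z⁻¹(log₂ x)⁻²`), from the LOWER half of
  Lemma 3 together with Mertens' theorem (`P_y ≥ 1/(4 log² y)`, from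
  `Literature.NumberTheory.LFunctions.Mertens.abs_prod_one_sub_inv_mul_log_sub_one_le`).

Main steps: `theta_sub_theta_eq` / `theta_sub_le_card_mul_log` (primes in `(B′, B]` via `ϑ`),
`theta_sub_theta_ge` (the error term on `[x/2, x]`), `oddPrimeProd_le_singProd` (`P_y ≤ 𝔖_y(m)`
for even `m`), `oddPrimeProd_ge` (Mertens from below), `card_Rm_ge` (`|𝓡_m| ≥ x/(8 log⁴ x)`),
and the assembly `proposition5_of_prime` (split `[A, B]` at `B′ = A + (δ/2)|𝓡_m| log x`, apply
Proposition 5′ with `(δ/2, η = δ/8)` on `[A, B′]`, and send the `≤ (δ/8)|𝓡_m|` uncovered primes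
injectively to primes `q ∈ (B′, B]`, using the class `p (mod q)`).

Consequently the inputs of Maynard's Theorem 1 in the tree are now: Lemma 2, Lemma 3, the GPY
measures of §4 (`GPYMeasures`), and the classical prime number theorem with error term
(`theorem1_of_GPYMeasures`).

## References

* J. Maynard, *Large gaps between primes*, Ann. of Math. (2) 183 (2016), 915–933; arXiv:1408.5110,
  §3 (first paragraph). [Maynard2016LargeGaps]
* H. L. Montgomery, R. C. Vaughan, *Multiplicative Number Theory I*, CUP 2007, Theorem 6.9 (prime
  number theorem with error term), Theorem 2.7 (Mertens). [MontgomeryVaughan2007]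
-/

open Filter Finset
open scoped Topology

namespace Literature.NumberTheory.Sieve

namespace Maynard2016

/-! ### Primes in `(B′, B]` via `ϑ` -/

/-- `ϑ(B) − ϑ(B′) = Σ_{B′ < p ≤ B} log p` (as a sum over the primes of `(⌊B′⌋, ⌊B⌋]`). [folklore] -/
private theorem theta_sub_theta_eq {B' B : ℝ} (h : B' ≤ B) :
    Chebyshev.theta B - Chebyshev.theta B' =
      ∑ p ∈ (Finset.Ioc ⌊B'⌋₊ ⌊B⌋₊).filter Nat.Prime, Real.log p := by
  have hfl : ⌊B'⌋₊ ≤ ⌊B⌋₊ := Nat.floor_mono h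
  have hθ : ∀ t : ℝ, Chebyshev.theta t =
      ∑ p ∈ (Finset.Ioc 0 ⌊t⌋₊).filter Nat.Prime, Real.log p := fun t => rfl
  have e : ∀ a b : ℕ, ∑ p ∈ (Finset.Ioc a b).filter Nat.Prime, Real.log p =
      ∑ n ∈ Finset.Ioc a b, (if n.Prime then Real.log n else 0) := fun a b => Finset.sum_filter _ _
  rw [hθ, hθ, e, e, e, ← Finset.sum_Ioc_consecutive _ (Nat.zero_le _) hfl]
  ring

/-- `ϑ(B) − ϑ(B′) ≤ #{primes in (B′, B]} · log B` (`B ≥ 1`). [folklore] -/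
private theorem theta_sub_le_card_mul_log {B' B : ℝ} (h : B' ≤ B) (hB1 : 1 ≤ B) :
    Chebyshev.theta B - Chebyshev.theta B' ≤
      (((Finset.Ioc ⌊B'⌋₊ ⌊B⌋₊).filter Nat.Prime).card : ℝ) * Real.log B := by
  rw [theta_sub_theta_eq h]
  have hle : ∀ p ∈ (Finset.Ioc ⌊B'⌋₊ ⌊B⌋₊).filter Nat.Prime, Real.log p ≤ Real.log B := by
    intro p hp
    rw [mem_filter, mem_Ioc] at hp
    have hpB : (p : ℝ) ≤ B :=
      calc (p : ℝ) ≤ ⌊B⌋₊ := by exact_mod_cast hp.1.2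
        _ ≤ B := Nat.floor_le (by linarith)
    exact Real.log_le_log (Nat.cast_pos.2 hp.2.pos) hpB
  calc ∑ p ∈ (Finset.Ioc ⌊B'⌋₊ ⌊B⌋₊).filter Nat.Prime, Real.log p
      ≤ ∑ p ∈ (Finset.Ioc ⌊B'⌋₊ ⌊B⌋₊).filter Nat.Prime, Real.log B := sum_le_sum hle
    _ = _ := by rw [sum_const, nsmul_eq_mul]

/-- The error term on `[x/2, x]`: if `|ϑ(t) − t| ≤ C t/(log t)^6` (`t ≥ 2`, `C ≥ 0`) then for
`x/2 ≤ B′ ≤ B ≤ x` (`x ≥ 4`), `ϑ(B) − ϑ(B′) ≥ (B − B′) − 2 C x/(log(x/2))^6`.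
[cite: MontgomeryVaughan2007, Thm 6.9] -/
theorem theta_sub_theta_ge {C x B' B : ℝ} (hC : 0 ≤ C)
    (hθ : ∀ t : ℝ, 2 ≤ t → |Chebyshev.theta t - t| ≤ C * t / Real.log t ^ (6 : ℝ))
    (hx : 4 ≤ x) (hA : x / 2 ≤ B') (hB'B : B' ≤ B) (hB : B ≤ x) :
    (B - B') - 2 * (C * x / Real.log (x / 2) ^ 6) ≤
      Chebyshev.theta B - Chebyshev.theta B' := by
  have hl2 : 0 < Real.log (x / 2) := Real.log_pos (by linarith)
  have key : ∀ t, x / 2 ≤ t → t ≤ x →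
      |Chebyshev.theta t - t| ≤ C * x / Real.log (x / 2) ^ 6 := by
    intro t ht1 ht2
    have hlt : Real.log (x / 2) ≤ Real.log t := Real.log_le_log (by linarith) ht1
    have h6 : Real.log t ^ (6 : ℝ) = Real.log t ^ 6 := by
      rw [show (6 : ℝ) = ((6 : ℕ) : ℝ) by norm_num, Real.rpow_natCast]
    have hpow : Real.log (x / 2) ^ 6 ≤ Real.log t ^ 6 := pow_le_pow_left₀ hl2.le hlt 6
    have hp0 : 0 < Real.log (x / 2) ^ 6 := pow_pos hl2 6
    calc |Chebyshev.theta t - t| ≤ C * t / Real.log t ^ (6 : ℝ) := hθ t (by linarith)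
      _ = C * t / Real.log t ^ 6 := by rw [h6]
      _ ≤ C * t / Real.log (x / 2) ^ 6 :=
          div_le_div_of_nonneg_left (mul_nonneg hC (by linarith)) hp0 hpow
      _ ≤ C * x / Real.log (x / 2) ^ 6 :=
          div_le_div_of_nonneg_right (mul_le_mul_of_nonneg_left ht2 hC) hp0.le
  have h1 := key B (le_trans hA hB'B) hB
  have h2 := key B' hA (le_trans hB'B hB)
  rw [abs_le] at h1 h2
  linarith [h1.1, h2.2]

/-! ### `|𝓡_m|` from below: `P_y ≤ 𝔖_y(m)` for even `m`, Mertens from below, Lemma 3 -/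

/-- For even `m`, `P_y = ∏_{2<p≤y}(p−2)/(p−1) ≤ 𝔖_y(m)` (the factors of `P_y` missing from
`𝔖_y(m)` are `≤ 1`). [cite: Maynard2016LargeGaps, §2 (definition of `𝔖_y(m)`)] -/
theorem oddPrimeProd_le_singProd (ε : ℝ) (x : ℕ) {m : ℕ} (hm : Even m) :
    oddPrimeProd ⌊y ε x⌋₊ ≤ singProd ε x m := by
  have hsub : (Finset.Iic ⌊y ε x⌋₊).filter (fun p => p.Prime ∧ ¬ p ∣ m) ⊆
      (Finset.Iic ⌊y ε x⌋₊).filter (fun p => p.Prime ∧ 2 < p) := by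
    intro p hp
    rw [mem_filter] at hp ⊢
    refine ⟨hp.1, hp.2.1, lt_of_le_of_ne hp.2.1.two_le ?_⟩
    intro h2
    exact hp.2.2 (h2 ▸ hm.two_dvd)
  have hr01 : ∀ p ∈ (Finset.Iic ⌊y ε x⌋₊).filter (fun p => p.Prime ∧ 2 < p),
      0 ≤ ((p : ℝ) - 2) / ((p : ℝ) - 1) ∧ ((p : ℝ) - 2) / ((p : ℝ) - 1) ≤ 1 := by
    intro p hp
    have h3 : (3 : ℝ) ≤ p := by exact_mod_cast (mem_filter.1 hp).2.2
    refine ⟨div_nonneg (by linarith) (by linarith), ?_⟩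
    rw [div_le_one (by linarith)]; linarith
  unfold oddPrimeProd singProd
  rw [← prod_sdiff hsub]
  have hD : ∏ p ∈ (Finset.Iic ⌊y ε x⌋₊).filter (fun p => p.Prime ∧ 2 < p) \
      (Finset.Iic ⌊y ε x⌋₊).filter (fun p => p.Prime ∧ ¬ p ∣ m), ((p : ℝ) - 2) / ((p : ℝ) - 1) ≤ 1 :=
    prod_le_one (fun p hp => (hr01 p (Finset.mem_sdiff.1 hp).1).1)
      (fun p hp => (hr01 p (Finset.mem_sdiff.1 hp).1).2)
  have hS0 : 0 ≤ ∏ p ∈ (Finset.Iic ⌊y ε x⌋₊).filter (fun p => p.Prime ∧ ¬ p ∣ m),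
      ((p : ℝ) - 2) / ((p : ℝ) - 1) :=
    prod_nonneg (fun p hp => (hr01 p (hsub hp)).1)
  calc (∏ p ∈ (Finset.Iic ⌊y ε x⌋₊).filter (fun p => p.Prime ∧ 2 < p) \
        (Finset.Iic ⌊y ε x⌋₊).filter (fun p => p.Prime ∧ ¬ p ∣ m), ((p : ℝ) - 2) / ((p : ℝ) - 1)) *
        ∏ p ∈ (Finset.Iic ⌊y ε x⌋₊).filter (fun p => p.Prime ∧ ¬ p ∣ m),
          ((p : ℝ) - 2) / ((p : ℝ) - 1)
      ≤ 1 * ∏ p ∈ (Finset.Iic ⌊y ε x⌋₊).filter (fun p => p.Prime ∧ ¬ p ∣ m),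
          ((p : ℝ) - 2) / ((p : ℝ) - 1) := mul_le_mul_of_nonneg_right hD hS0
    _ = _ := one_mul _

/-- **Mertens from below**: `P_Y = ∏_{2<p≤Y}(p−2)/(p−1) ≥ 1/(4 log² Y)` for `Y ≥ e^{48}`, from
`(p−2)/(p−1) ≥ (1 − 1/p)²`, `∏_{p≤Y}(1 − 1/p) ≥ 1/(2e^γ log Y) ≥ 1/(4 log Y)` (Mertens with the
explicit error of the tree, and `e^γ ≤ 2`). [cite: MontgomeryVaughan2007, Thm 2.7] -/
theorem oddPrimeProd_ge {Y : ℕ} (hY : Real.exp 48 ≤ Y) :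
    1 / (4 * Real.log Y ^ 2) ≤ oddPrimeProd Y := by
  classical
  have hY2 : (2 : ℝ) ≤ Y := by have := Real.add_one_le_exp (48 : ℝ); linarith
  have hlogY : 48 ≤ Real.log Y := by
    have := Real.log_le_log (Real.exp_pos 48) hY; rwa [Real.log_exp] at this
  have hlog0 : 0 < Real.log Y := by linarith
  -- Mertens
  have hM := Literature.NumberTheory.LFunctions.Mertens.abs_prod_one_sub_inv_mul_log_sub_one_le hY2
    (by linarith)
  rw [Nat.floor_natCast] at hM
  have hP0 : 0 ≤ ∏ p ∈ Nat.primesLE Y, (1 - (p : ℝ)⁻¹) :=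
    prod_nonneg fun p hp => by
      have h2 : (2 : ℝ) ≤ p := by exact_mod_cast (Nat.mem_primesLE.1 hp).2.two_le
      have : (p : ℝ)⁻¹ ≤ 1 / 2 := by
        rw [inv_eq_one_div]; exact div_le_div_of_nonneg_left zero_le_one two_pos h2
      linarith
  have heγ : Real.exp Real.eulerMascheroniConstant ≤ 2 := by
    have h1 : Real.eulerMascheroniConstant ≤ Real.log 2 := by
      have := Real.eulerMascheroniConstant_lt_two_thirds
      have := Real.log_two_gt_d9
      linarith
    calc Real.exp Real.eulerMascheroniConstant ≤ Real.exp (Real.log 2) := Real.exp_le_exp.2 h1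
      _ = 2 := Real.exp_log two_pos
  have hall : 1 / (4 * Real.log Y) ≤ ∏ p ∈ Nat.primesLE Y, (1 - (p : ℝ)⁻¹) := by
    have h1 := (abs_le.1 hM).1
    have h24 : 24 / Real.log Y ≤ 1 / 2 := by rw [div_le_iff₀ hlog0]; linarith
    have h2 : (∏ p ∈ Nat.primesLE Y, (1 - (p : ℝ)⁻¹)) *
        (Real.exp Real.eulerMascheroniConstant * Real.log Y) ≤
        (∏ p ∈ Nat.primesLE Y, (1 - (p : ℝ)⁻¹)) * (2 * Real.log Y) :=
      mul_le_mul_of_nonneg_left (mul_le_mul_of_nonneg_right heγ hlog0.le) hP0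
    rw [div_le_iff₀ (by positivity)]
    linarith
  -- remove the factor `p = 2`
  set O : Finset ℕ := (Finset.Iic Y).filter (fun p => p.Prime ∧ 2 < p) with hO
  have hY2n : 2 ≤ Y := by exact_mod_cast hY2
  have hins : Nat.primesLE Y = insert 2 O := by
    ext p
    rw [Nat.mem_primesLE, mem_insert, hO, mem_filter, mem_Iic]
    constructor
    · rintro ⟨hpY, hp⟩
      rcases eq_or_lt_of_le hp.two_le with h | h
      · exact Or.inl h.symm
      · exact Or.inr ⟨hpY, hp, h⟩
    · rintro (rfl | ⟨hpY, hp, -⟩)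
      · exact ⟨hY2n, Nat.prime_two⟩
      · exact ⟨hpY, hp⟩
  have h2O : (2 : ℕ) ∉ O := by rw [hO, mem_filter]; omega
  rw [hins, prod_insert h2O] at hall
  norm_num at hall
  -- `hall : (log Y)⁻¹ (1/4) ≤ (1/2) ∏_O (1 − 1/p)`, i.e. `∏_O (1 − 1/p) ≥ 1/(2 log Y)`
  have hOge : 1 / (2 * Real.log Y) ≤ ∏ p ∈ O, (1 - (p : ℝ)⁻¹) := by
    have : 1 / (2 * Real.log Y) = 2 * ((Real.log Y)⁻¹ * (1 / 4)) := by field_simp; ring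
    rw [this]; linarith
  -- termwise `(1 − 1/p)² ≤ (p−2)/(p−1)`
  have hsq : (∏ p ∈ O, (1 - (p : ℝ)⁻¹)) ^ 2 ≤ oddPrimeProd Y := by
    rw [oddPrimeProd, ← hO, ← prod_pow]
    refine prod_le_prod (fun p hp => sq_nonneg _) fun p hp => ?_
    have h3 : (3 : ℝ) ≤ p := by exact_mod_cast (mem_filter.1 hp).2.2
    have hp0 : (0 : ℝ) < p := by linarith
    rw [inv_eq_one_div, le_div_iff₀ (by linarith)]
    have e : (1 - 1 / (p : ℝ)) ^ 2 * ((p : ℝ) - 1) = ((p : ℝ) - 1) ^ 3 / (p : ℝ) ^ 2 := by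
      field_simp
    rw [e, div_le_iff₀ (by positivity)]
    nlinarith
  calc 1 / (4 * Real.log Y ^ 2) = (1 / (2 * Real.log Y)) ^ 2 := by field_simp; ring
    _ ≤ (∏ p ∈ O, (1 - (p : ℝ)⁻¹)) ^ 2 := pow_le_pow_left₀ (by positivity) hOge 2
    _ ≤ oddPrimeProd Y := hsq

/-- **`|𝓡_m| ≥ x/(8 log⁴ x)`** for even `m < U z⁻¹(log₂ x)⁻²`, from the lower half of Lemma 3
(relative error `κ ≤ 1/2`) at `V = U/m ≥ z (log₂ x)²`, `𝔖_y(m) ≥ P_y ≥ 1/(4 log² x)`.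
[cite: Maynard2016LargeGaps, §2, Lemma 3] -/
theorem card_Rm_ge {C_U ε κ : ℝ} {x m : ℕ} (hκ : κ ≤ 1 / 2) (hL : 1 ≤ Real.log x)
    (hL₂ : 4 ≤ Real.log (Real.log x)) (hL₂L : Real.log (Real.log x) ≤ Real.log x) (hz : 0 < z x)
    (hUx : U C_U ε x ≤ (x : ℝ) * Real.log x ^ 2)
    (hP : 1 / (4 * Real.log x ^ 2) ≤ oddPrimeProd ⌊y ε x⌋₊)
    (hm : 1 ≤ m) (hmx : m ≤ x) (hmev : Even m)
    (hmW : (m : ℝ) < U C_U ε x / (z x * Real.log (Real.log x) ^ 2))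
    (hL3 : ∀ V : ℝ, z x + z x / Real.log x ≤ V → V ≤ (x : ℝ) * Real.log x ^ 2 →
      ∀ m : ℕ, 1 ≤ m → m ≤ x →
        |((sievedPrimes ε x V m).card : ℝ) - (V - z x) / Real.log x * singProd ε x m| ≤
          κ * ((V - z x) / Real.log x * singProd ε x m)) :
    (x : ℝ) / (8 * Real.log x ^ 4) ≤ ((Rm C_U ε x m).card : ℝ) := by
  have hL0 : 0 < Real.log (x : ℝ) := by linarith
  have hL₂0 : 0 < Real.log (Real.log (x : ℝ)) := by linarith
  have hm0 : (0 : ℝ) < m := by exact_mod_cast hm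
  set V := U C_U ε x / m with hV
  -- `V ≥ z (log₂ x)² ≥ 16 z`
  have hVge : z x * Real.log (Real.log x) ^ 2 ≤ V := by
    rw [hV, le_div_iff₀ hm0]
    rw [lt_div_iff₀ (by positivity)] at hmW
    linarith
  have h16 : 16 * z x ≤ V := by
    have : z x * 16 ≤ z x * Real.log (Real.log x) ^ 2 :=
      mul_le_mul_of_nonneg_left (by nlinarith) hz.le
    linarith
  have hV1 : z x + z x / Real.log x ≤ V := by
    have : z x / Real.log x ≤ z x := div_le_self hz.le hL
    linarith
  have hU0 : 0 ≤ U C_U ε x := by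
    have hWpos : 0 < U C_U ε x / (z x * Real.log (Real.log x) ^ 2) := lt_of_le_of_lt hm0.le hmW
    have hd : 0 < z x * Real.log (Real.log x) ^ 2 := by positivity
    exact ((div_pos_iff_of_pos_right hd).1 hWpos).le
  have hV2 : V ≤ (x : ℝ) * Real.log x ^ 2 := by
    rw [hV]
    exact (div_le_self hU0 (by exact_mod_cast hm)).trans hUx
  have h3 := hL3 V hV1 hV2 m hm hmx
  set main := (V - z x) / Real.log x * singProd ε x m with hmain
  have hS0 : 0 ≤ singProd ε x m := singProd_nonneg ε x m
  have hmain0 : 0 ≤ main := by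
    rw [hmain]; exact mul_nonneg (div_nonneg (by linarith) hL0.le) hS0
  -- lower half of Lemma 3
  have hcard : main / 2 ≤ ((sievedPrimes ε x V m).card : ℝ) := by
    have h1 := (abs_le.1 h3).1
    have h2 : κ * main ≤ (1 / 2) * main := mul_le_mul_of_nonneg_right hκ hmain0
    linarith
  -- `main ≥ (z/log x) · (1/(4 log² x)) ≥ x/(4 log⁴ x)`
  have hmainge : (x : ℝ) / (4 * Real.log x ^ 4) ≤ main := by
    have hSge : 1 / (4 * Real.log x ^ 2) ≤ singProd ε x m :=
      hP.trans (oddPrimeProd_le_singProd ε x hmev)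
    have hfac : z x / Real.log x ≤ (V - z x) / Real.log x :=
      div_le_div_of_nonneg_right (by linarith) hL0.le
    have h1 : z x / Real.log x * (1 / (4 * Real.log x ^ 2)) ≤ main := by
      rw [hmain]
      exact mul_le_mul hfac hSge (by positivity) (div_nonneg (by linarith) hL0.le)
    have h2 : (x : ℝ) / (4 * Real.log x ^ 4) ≤ z x / Real.log x * (1 / (4 * Real.log x ^ 2)) := by
      rw [z]
      have hx0 : (0 : ℝ) ≤ x := Nat.cast_nonneg x
      have e : (x : ℝ) / Real.log (Real.log x) / Real.log x * (1 / (4 * Real.log x ^ 2)) =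
          (x : ℝ) / (4 * Real.log x ^ 4) * (Real.log x / Real.log (Real.log x)) := by
        field_simp
      rw [e]
      exact le_mul_of_one_le_right (by positivity) ((one_le_div hL₂0).2 hL₂L)
    exact h2.trans h1
  have hRm : Rm C_U ε x m = sievedPrimes ε x V m := by rw [Rm]
  rw [hRm]
  have : (x : ℝ) / (8 * Real.log x ^ 4) = (x : ℝ) / (4 * Real.log x ^ 4) / 2 := by ring
  rw [this]
  linarith

/-! ### Growth facts (real-variable, transferred to `x : ℕ`) -/

/-- `log t ≤ t/2`. [folklore] -/
private theorem log_le_half₅ {t : ℝ} (ht : 0 < t) : Real.log t ≤ t / 2 := by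
  have h1 := Real.log_le_sub_one_of_pos (half_pos ht)
  have h2 : Real.log (t / 2) = Real.log t - Real.log 2 := Real.log_div ht.ne' two_ne_zero
  have h3 : Real.log 2 < 1 := by have := Real.log_two_lt_d9; norm_num at this; linarith
  linarith

/-- Real-variable growth facts at `x : ℕ`. [folklore] -/
private theorem eventually_logs₅ {C_U K M : ℝ} (hC : 0 < C_U) :
    ∀ᶠ x : ℕ in atTop,
      1 ≤ Real.log x ∧ 4 ≤ Real.log (Real.log x) ∧ Real.log K ^ 2 ≤ Real.log (Real.log x) ∧
      C_U ≤ Real.log x ∧ 8 ≤ (x : ℝ) ∧ C_U * Real.log x + 1 ≤ (x : ℝ) / 4 ∧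
      Real.log (Real.log x) ≤ Real.log x / 100 ∧ M ≤ Real.log x := by
  have hT₂ : Tendsto (fun X : ℝ => Real.log (Real.log X)) atTop atTop :=
    Real.tendsto_log_atTop.comp Real.tendsto_log_atTop
  have hlin := Real.isLittleO_log_id_atTop.bound (show (0 : ℝ) < 1 / (8 * C_U) by positivity)
  have hlin100 := Real.tendsto_log_atTop.eventually
    (Real.isLittleO_log_id_atTop.bound (show (0 : ℝ) < 1 / 100 by norm_num))
  have hreal : ∀ᶠ X : ℝ in atTop, 1 ≤ Real.log X ∧ 4 ≤ Real.log (Real.log X) ∧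
      Real.log K ^ 2 ≤ Real.log (Real.log X) ∧
      C_U ≤ Real.log X ∧ 8 ≤ X ∧ C_U * Real.log X + 1 ≤ X / 4 ∧
      Real.log (Real.log X) ≤ Real.log X / 100 ∧ M ≤ Real.log X := by
    filter_upwards [hT₂.eventually_ge_atTop 4, hT₂.eventually_ge_atTop (Real.log K ^ 2), hlin,
      eventually_ge_atTop (8 : ℝ), Real.tendsto_log_atTop.eventually_ge_atTop 1,
      Real.tendsto_log_atTop.eventually_ge_atTop C_U, hlin100,
      Real.tendsto_log_atTop.eventually_ge_atTop M]
      with X h4 hK2 hlinX hX8 hlog1 hlogC hlin100X hM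
    refine ⟨hlog1, h4, hK2, hlogC, hX8, ?_, ?_, hM⟩
    · rw [Real.norm_eq_abs, Real.norm_eq_abs, id, abs_of_nonneg (by linarith),
        abs_of_nonneg (by linarith)] at hlinX
      have : C_U * Real.log X ≤ X / 8 := by
        have h := mul_le_mul_of_nonneg_left hlinX hC.le
        calc C_U * Real.log X ≤ C_U * (1 / (8 * C_U) * X) := h
          _ = X / 8 := by field_simp
      linarith
    · rw [Real.norm_eq_abs, Real.norm_eq_abs, id, abs_of_nonneg (by linarith),
        abs_of_nonneg (by linarith)] at hlin100X
      linarith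
  exact tendsto_natCast_atTop_atTop.eventually hreal

/-- `50 ≤ log y ≤ log x`. [cite: Maynard2016LargeGaps, (2.1)] -/
private theorem logy_facts₅ {ε : ℝ} {x : ℕ} (hε0 : 0 < ε) (hε : ε < 1 / 2)
    (hL : 1 ≤ Real.log x) (hL₂ : 4 ≤ Real.log (Real.log x))
    (h100 : Real.log (Real.log x) ≤ Real.log x / 100) :
    50 ≤ Real.log (y ε x) ∧ Real.log (y ε x) ≤ Real.log x := by
  have hL0 : 0 < Real.log (x : ℝ) := lt_of_lt_of_le one_pos hL
  have hL₂0 : 0 < Real.log (Real.log (x : ℝ)) := by linarith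
  have hL₃le : Real.log (Real.log (Real.log (x : ℝ))) ≤ Real.log (Real.log x) :=
    (Real.log_le_sub_one_of_pos hL₂0).trans (by linarith)
  have hL₃1 : 1 ≤ Real.log (Real.log (Real.log (x : ℝ))) := by
    have he4 : Real.exp 1 ≤ 4 := by have := Real.exp_one_lt_d9; linarith
    have h1 : (1 : ℝ) ≤ Real.log 4 := by
      have := Real.log_le_log (Real.exp_pos 1) he4; rwa [Real.log_exp] at this
    exact h1.trans (Real.log_le_log (by norm_num) hL₂)
  set T := Real.log (x : ℝ) * Real.log (Real.log (Real.log x)) / Real.log (Real.log x) with hT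
  have hT100 : 100 ≤ T := by
    rw [hT, le_div_iff₀ hL₂0]
    have h1 : 100 * Real.log (Real.log (x : ℝ)) ≤ Real.log x := by linarith
    calc 100 * Real.log (Real.log (x : ℝ)) ≤ Real.log x := h1
      _ ≤ Real.log x * Real.log (Real.log (Real.log x)) := le_mul_of_one_le_right hL0.le hL₃1
  have hTle : T ≤ Real.log x := by
    rw [hT, div_le_iff₀ hL₂0]
    exact mul_le_mul_of_nonneg_left hL₃le hL0.le
  have hly : Real.log (y ε x) = (1 - ε) * T := by rw [log_y]
  have hT0 : 0 ≤ T := by linarith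
  refine ⟨?_, ?_⟩
  · rw [hly]; nlinarith
  · rw [hly]; nlinarith

/-- `⌊y⌋ ≥ e^{48}` and `0 < log ⌊y⌋ ≤ log y` once `log y ≥ 50`. [folklore] -/
private theorem floor_y_facts₅ {ε : ℝ} {x : ℕ} (hly : 50 ≤ Real.log (y ε x)) :
    Real.exp 48 ≤ (⌊y ε x⌋₊ : ℝ) ∧ 0 < Real.log (⌊y ε x⌋₊ : ℝ) ∧
      Real.log (⌊y ε x⌋₊ : ℝ) ≤ Real.log (y ε x) := by
  have hy0 : 0 < y ε x := Real.exp_pos _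
  have hyexp : Real.exp 50 ≤ y ε x := by
    have := Real.exp_le_exp.2 hly; rwa [Real.exp_log hy0] at this
  have hYfloor : y ε x - 1 < (⌊y ε x⌋₊ : ℝ) := by
    have := Nat.lt_floor_add_one (y ε x); linarith
  have he : 2 * Real.exp 48 + 2 ≤ Real.exp 50 := by
    have h1 : Real.exp 50 = Real.exp 48 * Real.exp 2 := by rw [← Real.exp_add]; norm_num
    have h2 : (3 : ℝ) ≤ Real.exp 2 := by have := Real.add_one_le_exp (2 : ℝ); linarith
    have h3 : (2 : ℝ) ≤ Real.exp 48 := by have := Real.add_one_le_exp (48 : ℝ); linarith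
    nlinarith
  have hY48 : Real.exp 48 ≤ (⌊y ε x⌋₊ : ℝ) := by linarith
  have hY1 : (1 : ℝ) < ⌊y ε x⌋₊ := lt_of_lt_of_le (by have := Real.add_one_le_exp (48 : ℝ); linarith) hY48
  refine ⟨hY48, Real.log_pos hY1, Real.log_le_log (by linarith) (Nat.floor_le hy0.le)⟩

/-- `K e^{−√(log₂ x)} ≤ 1/2` once `log₂ x ≥ (log 2K)²`. [folklore] -/
private theorem kappa_le_half {K t : ℝ} (hK : 0 < K) (ht : Real.log (2 * K) ^ 2 ≤ t) :
    K * Real.exp (-t ^ ((1 : ℝ) / 2)) ≤ 1 / 2 := by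
  have hsq : Real.log (2 * K) ≤ t ^ ((1 : ℝ) / 2) := by
    rw [← Real.sqrt_eq_rpow]
    rcases le_or_gt (Real.log (2 * K)) 0 with hneg | hpos
    · exact hneg.trans (Real.sqrt_nonneg _)
    · calc Real.log (2 * K) = Real.sqrt (Real.log (2 * K) ^ 2) := (Real.sqrt_sq hpos.le).symm
        _ ≤ Real.sqrt t := Real.sqrt_le_sqrt ht
  have h1 : 2 * K ≤ Real.exp (t ^ ((1 : ℝ) / 2)) := by
    calc 2 * K = Real.exp (Real.log (2 * K)) := (Real.exp_log (by positivity)).symm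
      _ ≤ _ := Real.exp_le_exp.2 hsq
  have h2 : 2 * K * Real.exp (-t ^ ((1 : ℝ) / 2)) ≤ 1 :=
    calc 2 * K * Real.exp (-t ^ ((1 : ℝ) / 2))
        ≤ Real.exp (t ^ ((1 : ℝ) / 2)) * Real.exp (-t ^ ((1 : ℝ) / 2)) :=
          mul_le_mul_of_nonneg_right h1 (Real.exp_pos _).le
      _ = 1 := by rw [← Real.exp_add, add_neg_cancel, Real.exp_zero]
  linarith

/-- The facts used at a large `x`: sizes of `log x, log₂ x, z, U`, `U/z ≤ x/4`, `κ ≤ 1/2`,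
`P_y ≥ 1/(4 log² x)`, `log(x/2) ≥ (log x)/2`, and `M ≤ log x`.
[cite: Maynard2016LargeGaps, (2.1)] -/
private theorem eventually_facts₅ {C_U ε K M : ℝ} (hC : 0 < C_U) (hε0 : 0 < ε) (hε : ε < 1 / 2)
    (hK : 0 < K) :
    ∀ᶠ x : ℕ in atTop,
      1 ≤ Real.log x ∧ 4 ≤ Real.log (Real.log x) ∧ Real.log (Real.log x) ≤ Real.log x ∧
      8 ≤ (x : ℝ) ∧ 0 < z x ∧ U C_U ε x ≤ (x : ℝ) * Real.log x ^ 2 ∧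
      U C_U ε x / z x ≤ (x : ℝ) / 4 ∧
      K * Real.exp (-(Real.log (Real.log x)) ^ ((1 : ℝ) / 2)) ≤ 1 / 2 ∧
      1 / (4 * Real.log x ^ 2) ≤ oddPrimeProd ⌊y ε x⌋₊ ∧
      Real.log x / 2 ≤ Real.log ((x : ℝ) / 2) ∧ M ≤ Real.log x := by
  filter_upwards [eventually_logs₅ (K := 2 * K) (M := M) hC] with x hx
  obtain ⟨hlog1, h4, hK2, hlogC, hx8, hlinx, h100, hM⟩ := hx
  obtain ⟨hly50, hlyL⟩ := logy_facts₅ hε0 hε hlog1 h4 h100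
  obtain ⟨hY48, hlogY0, hlogYle⟩ := floor_y_facts₅ hly50
  have hx0 : (0 : ℝ) < x := by linarith
  have hL0 : 0 < Real.log (x : ℝ) := by linarith
  have hL₂0 : 0 < Real.log (Real.log (x : ℝ)) := by linarith
  have hly0 : 0 < Real.log (y ε x) := by linarith
  have hz0 : 0 < z x := by rw [z]; positivity
  have hUle : U C_U ε x ≤ (x : ℝ) * Real.log x ^ 2 := by
    rw [U]
    have h1 : (x : ℝ) * Real.log (y ε x) / Real.log (Real.log x) ≤ (x : ℝ) * Real.log x := by
      rw [div_le_iff₀ hL₂0]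
      have h2 : (x : ℝ) * Real.log (y ε x) ≤ (x : ℝ) * Real.log x :=
        mul_le_mul_of_nonneg_left hlyL hx0.le
      exact h2.trans (le_mul_of_one_le_right (by positivity) (by linarith))
    calc C_U * ((x : ℝ) * Real.log (y ε x) / Real.log (Real.log x))
        ≤ C_U * ((x : ℝ) * Real.log x) := mul_le_mul_of_nonneg_left h1 hC.le
      _ ≤ Real.log x * ((x : ℝ) * Real.log x) := mul_le_mul_of_nonneg_right hlogC (by positivity)
      _ = (x : ℝ) * Real.log x ^ 2 := by ring
  have hUz : U C_U ε x / z x ≤ (x : ℝ) / 4 := by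
    have : U C_U ε x / z x = C_U * Real.log (y ε x) := by rw [U, z]; field_simp
    rw [this]
    calc C_U * Real.log (y ε x) ≤ C_U * Real.log x := mul_le_mul_of_nonneg_left hlyL hC.le
      _ ≤ (x : ℝ) / 4 := by linarith
  have hP : 1 / (4 * Real.log x ^ 2) ≤ oddPrimeProd ⌊y ε x⌋₊ := by
    refine le_trans ?_ (oddPrimeProd_ge hY48)
    have : Real.log (⌊y ε x⌋₊ : ℝ) ≤ Real.log x := hlogYle.trans hlyL
    have : Real.log (⌊y ε x⌋₊ : ℝ) ^ 2 ≤ Real.log x ^ 2 := pow_le_pow_left₀ hlogY0.le this 2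
    exact div_le_div_of_nonneg_left zero_le_one (mul_pos four_pos (pow_pos hlogY0 2)) (by linarith)
  have hhalf : Real.log x / 2 ≤ Real.log ((x : ℝ) / 2) := by
    rw [Real.log_div hx0.ne' two_ne_zero]
    have h2 : Real.log 2 < 1 := by have := Real.log_two_lt_d9; norm_num at this; linarith
    have : (2 : ℝ) ≤ Real.log x := by
      have h8 : Real.log 8 ≤ Real.log (x : ℝ) := Real.log_le_log (by norm_num) hx8
      have : Real.log (8 : ℝ) = 3 * Real.log 2 := by
        rw [show (8 : ℝ) = 2 ^ 3 by norm_num, Real.log_pow]; norm_num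
      have h2' : 0.6931471803 < Real.log 2 := Real.log_two_gt_d9
      linarith
    linarith
  exact ⟨hlog1, h4, by linarith, hx8, hz0, hUle, hUz, kappa_le_half hK hK2, hP, hhalf, hM⟩

/-! ### An injection between finsets -/

/-- From `|S| ≤ |T|`, an injection `S → T` (as a function on `ℕ`). [folklore] -/
private theorem exists_injOn_of_card_le₅ {S T : Finset ℕ} (h : S.card ≤ T.card) :
    ∃ f : ℕ → ℕ, Set.InjOn f S ∧ ∀ s ∈ S, f s ∈ T := by
  classical
  obtain ⟨T', hT'T, hcardT'⟩ := le_card_iff_exists_subset_card.1 h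
  let e : S ≃ T' := equivOfCardEq hcardT'.symm
  refine ⟨fun s => if hs : s ∈ S then ((e ⟨s, hs⟩ : T') : ℕ) else 0, ?_, ?_⟩
  · intro s₁ hs₁ s₂ hs₂ heq
    have hs₁' : s₁ ∈ S := by simpa using hs₁
    have hs₂' : s₂ ∈ S := by simpa using hs₂
    simp only [hs₁', hs₂', dif_pos] at heq
    have := e.injective (Subtype.ext heq)
    simpa using this
  · intro s hs
    simp only [hs, dif_pos]
    exact hT'T (e ⟨s, hs⟩).2

/-! ### The assembly -/

/-- **Maynard 2016, §3 (first paragraph), PROVED: Proposition 5′ ⇒ Proposition 5**, given Lemma 3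
(for `|𝓡_m| ≫ x/log⁴ x`) and the prime number theorem with de la Vallée Poussin's error term (for
the primes of the appended interval). Split `[A, B]` at `B′ = A + (δ/2)|𝓡_m| log x`; Proposition 5′
with `(δ/2, η = δ/8)` covers all but `(δ/8)|𝓡_m|` elements of `𝓡_m` by classes of primes
`q ≤ B′`; the interval `(B′, B]` has length `≥ (δ/2)|𝓡_m| log x ≥ δ x/(16 log³ x)` and so contains
`≥ (δ/8)|𝓡_m|` primes, one for each remaining `p` (class `p (mod q)`).
[cite: Maynard2016LargeGaps, §3 (first paragraph)] -/
theorem proposition5_of_prime (h5 : Proposition5Prime) (h3 : Lemma3)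
    (hθ : Literature.NumberTheory.LFunctions.ChebyshevThetaDeLaValleePoussin) :
    Literature.NumberTheory.Sieve.Maynard2016.Proposition5 := by
  obtain ⟨C, hC⟩ := hθ.logPow 6
  set C' : ℝ := max C 0 with hC'
  have hC'0 : 0 ≤ C' := le_max_right _ _
  have hθ' : ∀ t : ℝ, 2 ≤ t → |Chebyshev.theta t - t| ≤ C' * t / Real.log t ^ (6 : ℝ) := by
    intro t ht
    refine (hC t ht).trans ?_
    have hl : 0 < Real.log t ^ (6 : ℝ) := Real.rpow_pos_of_pos (Real.log_pos (by linarith)) _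
    exact div_le_div_of_nonneg_right (mul_le_mul_of_nonneg_right (le_max_left C 0) (by linarith))
      hl.le
  intro C_U hCU
  have hε_small : ∀ᶠ ε : ℝ in 𝓝[>] 0, 0 < ε ∧ ε < 1 / 2 := by
    have h1 : ∀ᶠ ε : ℝ in 𝓝[>] 0, ε ∈ Set.Ioo (0 : ℝ) (1 / 2) :=
      Ioo_mem_nhdsGT (by norm_num : (0 : ℝ) < 1 / 2)
    filter_upwards [h1] with ε hε using hε
  filter_upwards [h5 C_U hCU, h3, hε_small] with ε h5ε h3ε hε
  obtain ⟨K, hK, h3x⟩ := h3ε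
  intro δ hδ
  filter_upwards [h5ε (δ / 2) (by positivity) (δ / 8) (by positivity), h3x,
    eventually_facts₅ (M := 8192 * C' / (3 * δ) + 1) hCU hε.1 hε.2 hK] with x h5x h3xx hfx
  obtain ⟨hL1, hL₂4, hL₂L, hx8, hz0, hUx, hUz, hκ, hP, hhalf, hM⟩ := hfx
  intro m hm1 hmev hmW A B hA hB hlen
  -- notation
  set R := Rm C_U ε x m with hR
  set N : ℝ := (R.card : ℝ) with hN
  set L : ℝ := Real.log x with hLdef
  have hx0 : (0 : ℝ) < x := by linarith
  have hL0 : 0 < L := by rw [hLdef]; linarith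
  have hN0 : 0 ≤ N := Nat.cast_nonneg _
  have hNL0 : 0 ≤ N * L := mul_nonneg hN0 hL0.le
  -- `m ≤ x`
  have hmx : m ≤ x := by
    have hL₂0 : 0 < Real.log (Real.log (x : ℝ)) := by linarith
    have hWpos : 0 < U C_U ε x / (z x * Real.log (Real.log x) ^ 2) :=
      lt_of_le_of_lt (Nat.cast_nonneg m) hmW
    have hd : 0 < z x * Real.log (Real.log x) ^ 2 := by positivity
    have hU0 : 0 < U C_U ε x := (div_pos_iff_of_pos_right hd).1 hWpos
    have h1sq : (1 : ℝ) ≤ Real.log (Real.log x) ^ 2 := one_le_pow₀ (by linarith)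
    have hW : U C_U ε x / (z x * Real.log (Real.log x) ^ 2) ≤ U C_U ε x / z x :=
      div_le_div_of_nonneg_left hU0.le hz0 (le_mul_of_one_le_right hz0.le h1sq)
    have : (m : ℝ) ≤ x := by linarith
    exact_mod_cast this
  -- `|𝓡_m| ≥ x/(8 log⁴ x)`
  have hNge : (x : ℝ) / (8 * L ^ 4) ≤ N :=
    card_Rm_ge hκ hL1 hL₂4 hL₂L hz0 hUx hP hm1 hmx hmev hmW h3xx
  -- the split point
  set B' : ℝ := A + δ / 2 * N * L with hB'def
  have hδNL : 0 ≤ δ * N * L := by positivity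
  have hlen' : δ * N * L ≤ B - A := hlen
  have hB'B : B' ≤ B := by
    have : δ / 2 * N * L ≤ δ * N * L := by linarith
    linarith
  have hAB' : A ≤ B' := by have : 0 ≤ δ / 2 * N * L := by positivity
                           linarith
  have hB'x : B' ≤ x := hB'B.trans hB
  have hB0 : 0 ≤ B := by linarith
  have hB'0 : 0 ≤ B' := by linarith
  -- Proposition 5′ on `[A, B′]`
  have hlen5 : δ / 2 * ((Rm C_U ε x m).card : ℝ) * Real.log x ≤ B' - A := by
    show δ / 2 * N * L ≤ B' - A
    linarith
  obtain ⟨a', ha'⟩ := h5x m hm1 hmev hmW A B' hA hB'x hlen5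
  set Lset := (Rm C_U ε x m).filter (fun p => ¬ ∃ q ∈ intervalPrimes A B', p ≡ a' q [MOD q])
    with hLset
  have hLcard : (Lset.card : ℝ) ≤ δ / 8 * N := ha'
  -- primes of `(B′, B]`
  set T := (Finset.Ioc ⌊B'⌋₊ ⌊B⌋₊).filter Nat.Prime with hT
  have hTcard : δ / 8 * N ≤ (T.card : ℝ) := by
    have hx4 : (4 : ℝ) ≤ x := by linarith
    have h1 := theta_sub_theta_ge hC'0 hθ' hx4 (le_trans hA hAB') hB'B hB
    have h2 := theta_sub_le_card_mul_log hB'B (by linarith)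
    have hlogB : Real.log B ≤ L := Real.log_le_log (by linarith) hB
    have h3 : (T.card : ℝ) * Real.log B ≤ (T.card : ℝ) * L :=
      mul_le_mul_of_nonneg_left hlogB (Nat.cast_nonneg _)
    -- error term: `2 C' x/(log(x/2))^6 ≤ 128 C' x / L^6 ≤ (3δ/8) N L`
    have hl2 : 0 < Real.log ((x : ℝ) / 2) := by linarith
    have hE : 2 * (C' * x / Real.log ((x : ℝ) / 2) ^ 6) ≤ 128 * C' * x / L ^ 6 := by
      have hpow : (L / 2) ^ 6 ≤ Real.log ((x : ℝ) / 2) ^ 6 :=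
        pow_le_pow_left₀ (by positivity) hhalf 6
      have h6 : (L / 2) ^ 6 = L ^ 6 / 64 := by ring
      rw [h6] at hpow
      calc 2 * (C' * x / Real.log ((x : ℝ) / 2) ^ 6) ≤ 2 * (C' * x / (L ^ 6 / 64)) := by
            apply mul_le_mul_of_nonneg_left _ zero_le_two
            exact div_le_div_of_nonneg_left (by positivity) (by positivity) hpow
        _ = 128 * C' * x / L ^ 6 := by field_simp; ring
    have hM' : 8192 * C' ≤ 3 * δ * L ^ 3 := by
      have hL3 : L ≤ L ^ 3 := by
        have hL1' : 1 ≤ L := hL1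
        calc L = L * 1 * 1 := by ring
          _ ≤ L * L * L :=
              mul_le_mul (mul_le_mul_of_nonneg_left hL1' hL0.le) hL1' zero_le_one (by positivity)
          _ = L ^ 3 := by ring
      have h1 : 8192 * C' / (3 * δ) ≤ L := by linarith
      rw [div_le_iff₀ (by positivity)] at h1
      calc 8192 * C' ≤ L * (3 * δ) := h1
        _ = 3 * δ * L := by ring
        _ ≤ 3 * δ * L ^ 3 := mul_le_mul_of_nonneg_left hL3 (by positivity)
    have hErr : 128 * C' * x / L ^ 6 ≤ 3 * δ / 8 * N * L := by
      have h1 : 3 * δ / 8 * ((x : ℝ) / (8 * L ^ 4)) * L ≤ 3 * δ / 8 * N * L := by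
        apply mul_le_mul_of_nonneg_right _ hL0.le
        exact mul_le_mul_of_nonneg_left hNge (by positivity)
      refine le_trans ?_ h1
      rw [div_le_iff₀ (by positivity)]
      have : 3 * δ / 8 * ((x : ℝ) / (8 * L ^ 4)) * L * L ^ 6 = (3 * δ * L ^ 3) * x / 64 := by
        field_simp; ring
      rw [this]
      have hx0' : (0 : ℝ) ≤ x := hx0.le
      calc 128 * C' * x = 8192 * C' * x / 64 := by ring
        _ ≤ 3 * δ * L ^ 3 * x / 64 :=
            div_le_div_of_nonneg_right (mul_le_mul_of_nonneg_right hM' hx0') (by norm_num)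
    have hlenB : δ / 2 * N * L ≤ B - B' := by
      have : B' = A + δ / 2 * N * L := hB'def
      linarith
    -- combine: `T.card · L ≥ (B − B′) − err ≥ (δ/2 − 3δ/8) N L = (δ/8) N L`
    have h4 : δ / 8 * N * L ≤ (T.card : ℝ) * L := by linarith
    exact le_of_mul_le_mul_right (by linarith) hL0
  have hLT : Lset.card ≤ T.card := by exact_mod_cast hLcard.trans hTcard
  obtain ⟨f, hfinj, hfT⟩ := exists_injOn_of_card_le₅ hLT
  -- the residue classes
  refine ⟨fun q => if (q : ℝ) ≤ B' then a' q else (Function.invFunOn f (Lset : Set ℕ) q) % q, ?_⟩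
  intro p hp
  by_cases hpL : p ∈ Lset
  · -- a leftover prime: use `q = f p ∈ (B′, B]` and the class `p (mod q)`
    have hq := hfT p hpL
    rw [hT, mem_filter, mem_Ioc] at hq
    have hqB' : B' < (f p : ℝ) := (Nat.floor_lt hB'0).1 hq.1.1
    have hqB : (f p : ℝ) ≤ B := (Nat.le_floor_iff hB0).1 hq.1.2
    refine ⟨f p, hq.2, by linarith, hqB, ?_⟩
    have hinv : Function.invFunOn f (Lset : Set ℕ) (f p) = p :=
      hfinj.leftInvOn_invFunOn (by exact_mod_cast hpL)
    simp only [if_neg (not_le.2 hqB'), hinv]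
    exact (Nat.mod_modEq p (f p)).symm
  · -- covered by Proposition 5′
    have hcov : ∃ q ∈ intervalPrimes A B', p ≡ a' q [MOD q] := by
      by_contra hnot
      exact hpL (mem_filter.2 ⟨hp, hnot⟩)
    obtain ⟨q, hq, hpq⟩ := hcov
    have hq' := (mem_intervalPrimes hB'0).1 hq
    refine ⟨q, hq'.1, hq'.2.1, hq'.2.2.trans hB'B, ?_⟩
    simp only [if_pos hq'.2.2]
    exact hpq

/-- Hence the inputs of Maynard's Theorem 1 in the tree: Lemma 2, Lemma 3, the GPY measures of §4,
and the prime number theorem with de la Vallée Poussin's error term.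
[cite: Maynard2016LargeGaps, Thm 1] -/
theorem theorem1_of_GPYMeasures (h₂ : Lemma2) (h₃ : Lemma3) (hμ : GPYMeasures)
    (hθ : Literature.NumberTheory.LFunctions.ChebyshevThetaDeLaValleePoussin) :
    Literature.NumberTheory.Sieve.Maynard2016_theorem1 :=
  theorem1_of_lemmas h₂ h₃
    (proposition5_of_prime (proposition5Prime_of_GPYMeasures hμ) h₃ hθ)

/-- … and Rankin's bound with an arbitrarily large constant. [cite: Maynard2016LargeGaps, Thm 1] -/
theorem forall_rankinConstant_of_GPYMeasures (h₂ : Lemma2) (h₃ : Lemma3) (hμ : GPYMeasures)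
    (hθ : Literature.NumberTheory.LFunctions.ChebyshevThetaDeLaValleePoussin) (c : ℝ) :
    Literature.NumberTheory.Sieve.RankinConstant c :=
  forall_rankinConstant_of_lemmas h₂ h₃
    (proposition5_of_prime (proposition5Prime_of_GPYMeasures hμ) h₃ hθ) c

end Maynard2016

end Literature.NumberTheory.Sieve
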